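import Mathlib
import HarnessLib
import Summits.Parity.BatemanHorn.Theorems.IsogenyRedeiSplitBlockJacobiAbel

/-!
# Support lemmas for `stub_mbb_of_boxInputs` (line `Sketch`, crux `SplitBlockJacobiCorner`,
# stmt-Parity-15002): Abel summation against tensor weights (Type I × Type I pieces and the
# removal of the `1/log` weights)

Kernel-free consequences of the landed two-dimensional Abel bound `norm_sum_sum_mul_le_abel2`
(`…SplitBlockJacobiAbel`):

* `variation_tensor` — for a tensor weight `g(i,j) = u(i)v(j)` the Abel variation factorises,
  `V(u ⊗ v) = V(u)·V(v)` with `V(u) = ‖u(a')‖ + Σ_{a ≤ m < a'} ‖u(m+1) − u(m)‖`;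
* `weighted_box_bound` — `‖Σ_{i,j} f(i,j) u(i) v(j)‖ ≤ B·V_u·V_v` when every anchored sub-box sum
  of `f` is `≤ B`;
* `box_split` — anchored sub-box sums up to `2A+1` from the dyadic-compatible boxes `(A,m]`,
  `(2A, m]` (K1′ asks `m ≤ 2A`);
* `log_weight_variation`, `norm_log_weight_le` — the Type I weight `a₁ log n + a₀`, `|a₁| ≤ 1`, has
  variation `≤ log A' − log A` on `[A, A']`;
* `antitone_weight_variation` — a non-increasing non-negative weight has `V(w) = w(a)` (used for
  `w = 1/log`).
-/

noncomputable section

open Finset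

namespace Summit.Parity.BatemanHorn.Cruxes.SplitBlockJacobiCorner.Sketch.MbbOfBoxInputs

/-- **Tensor weights have product variation.** [folklore] -/
theorem variation_tensor (u v : ℕ → ℂ) (a a' b b' : ℕ) :
    ‖u a' * v b'‖ + ∑ m ∈ Ico a a', ‖u (m + 1) * v b' - u m * v b'‖ +
        ∑ n ∈ Ico b b', ‖u a' * v (n + 1) - u a' * v n‖ +
        ∑ m ∈ Ico a a', ∑ n ∈ Ico b b',
          ‖u (m + 1) * v (n + 1) - u (m + 1) * v n - u m * v (n + 1) + u m * v n‖ =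
      (‖u a'‖ + ∑ m ∈ Ico a a', ‖u (m + 1) - u m‖) *
        (‖v b'‖ + ∑ n ∈ Ico b b', ‖v (n + 1) - v n‖) := by
  have e1 : ∀ m, ‖u (m + 1) * v b' - u m * v b'‖ = ‖u (m + 1) - u m‖ * ‖v b'‖ := fun m => by
    rw [← sub_mul, norm_mul]
  have e2 : ∀ n, ‖u a' * v (n + 1) - u a' * v n‖ = ‖u a'‖ * ‖v (n + 1) - v n‖ := fun n => by
    rw [← mul_sub, norm_mul]
  have e3 : ∀ m n, ‖u (m + 1) * v (n + 1) - u (m + 1) * v n - u m * v (n + 1) + u m * v n‖ =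
      ‖u (m + 1) - u m‖ * ‖v (n + 1) - v n‖ := fun m n => by
    rw [← norm_mul]; congr 1; ring
  simp_rw [e1, e2, e3, norm_mul]
  rw [← Finset.sum_mul, ← Finset.mul_sum]
  simp_rw [← Finset.mul_sum]
  rw [← Finset.sum_mul]
  ring

/-- **Weighted box bound** (2D Abel against a tensor weight): if every anchored sub-box sum of `f`
on `(a,a'] × (b,b']` has norm `≤ B`, and the variations of `u`, `v` are `≤ V_u`, `≤ V_v`, then
`‖Σ f(i,j)·(u(i)v(j))‖ ≤ B·(V_u V_v)`. [folklore] -/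
theorem weighted_box_bound (f : ℕ → ℕ → ℂ) (u v : ℕ → ℂ) {a a' b b' : ℕ} (ha : a ≤ a')
    (hb : b ≤ b') {B Vu Vv : ℝ}
    (hB : ∀ m ∈ Icc a a', ∀ n ∈ Icc b b', ‖∑ i ∈ Ioc a m, ∑ j ∈ Ioc b n, f i j‖ ≤ B)
    (hu : ‖u a'‖ + ∑ m ∈ Ico a a', ‖u (m + 1) - u m‖ ≤ Vu)
    (hv : ‖v b'‖ + ∑ n ∈ Ico b b', ‖v (n + 1) - v n‖ ≤ Vv) :
    ‖∑ i ∈ Ioc a a', ∑ j ∈ Ioc b b', f i j * (u i * v j)‖ ≤ B * (Vu * Vv) := by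
  have hB0 : 0 ≤ B := (norm_nonneg _).trans (hB a (Finset.mem_Icc.mpr ⟨le_rfl, ha⟩) b
    (Finset.mem_Icc.mpr ⟨le_rfl, hb⟩))
  have hA := Summit.Parity.BatemanHorn.Cruxes.SplitBlockJacobi.CofactorRootDiscrepancy.norm_sum_sum_mul_le_abel2
    f (fun i j => u i * v j) ha hb hB
  rw [variation_tensor u v a a' b b'] at hA
  refine hA.trans (mul_le_mul_of_nonneg_left ?_ hB0)
  have hu0 : 0 ≤ ‖u a'‖ + ∑ m ∈ Ico a a', ‖u (m + 1) - u m‖ :=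
    add_nonneg (norm_nonneg _) (Finset.sum_nonneg fun _ _ => norm_nonneg _)
  have hv0 : 0 ≤ ‖v b'‖ + ∑ n ∈ Ico b b', ‖v (n + 1) - v n‖ :=
    add_nonneg (norm_nonneg _) (Finset.sum_nonneg fun _ _ => norm_nonneg _)
  exact mul_le_mul hu hv hv0 (hu0.trans hu)

/-- **From dyadic-compatible boxes to all anchored sub-boxes.** If the box sums of `f` over
`(A₀, m] × (B₀, m']` are `≤ Z₀` for `A₀ ∈ {A, 2A}`, `A₀ ≤ m ≤ 2A₀` (and likewise in the second
variable), then every anchored sub-box `(A, m] × (B, m']` with `m ≤ 2A+1`, `m' ≤ 2B+1` has sum of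
norm `≤ 4 Z₀` (`A, B ≥ 1`). [folklore] -/
theorem box_split (f : ℕ → ℕ → ℂ) {A B : ℕ} (hA : 1 ≤ A) (hB : 1 ≤ B) {Z₀ : ℝ} (hZ : 0 ≤ Z₀)
    (hK : ∀ A₀ B₀ m m' : ℕ, (A₀ = A ∨ A₀ = 2 * A) → (B₀ = B ∨ B₀ = 2 * B) →
      A₀ ≤ m → m ≤ 2 * A₀ → B₀ ≤ m' → m' ≤ 2 * B₀ →
        ‖∑ n ∈ Ioc A₀ m, ∑ q ∈ Ioc B₀ m', f n q‖ ≤ Z₀) :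
    ∀ m ∈ Icc A (2 * A + 1), ∀ m' ∈ Icc B (2 * B + 1),
      ‖∑ n ∈ Ioc A m, ∑ q ∈ Ioc B m', f n q‖ ≤ 4 * Z₀ := by
  intro m hm m' hm'
  rw [Finset.mem_Icc] at hm hm'
  -- one variable at a time: the `q`-sums over `(B, m']` for any admissible `m'`
  have hq : ∀ A₀ mm : ℕ, (A₀ = A ∨ A₀ = 2 * A) → A₀ ≤ mm → mm ≤ 2 * A₀ →
      ‖∑ n ∈ Ioc A₀ mm, ∑ q ∈ Ioc B m', f n q‖ ≤ 2 * Z₀ := by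
    intro A₀ mm hA₀ h1 h2
    rcases le_or_gt m' (2 * B) with hle | hgt
    · calc _ ≤ Z₀ := hK A₀ B mm m' hA₀ (Or.inl rfl) h1 h2 hm'.1 hle
        _ ≤ 2 * Z₀ := by linarith
    · have hm'eq : m' = 2 * B + 1 := by omega
      have hsplit : ∀ n, ∑ q ∈ Ioc B m', f n q =
          ∑ q ∈ Ioc B (2 * B), f n q + ∑ q ∈ Ioc (2 * B) m', f n q := fun n =>
        (Finset.sum_Ioc_consecutive (f n) (by omega) (by omega)).symm
      simp_rw [hsplit, Finset.sum_add_distrib]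
      calc _ ≤ ‖∑ n ∈ Ioc A₀ mm, ∑ q ∈ Ioc B (2 * B), f n q‖ +
            ‖∑ n ∈ Ioc A₀ mm, ∑ q ∈ Ioc (2 * B) m', f n q‖ := norm_add_le _ _
        _ ≤ Z₀ + Z₀ := add_le_add (hK A₀ B mm (2 * B) hA₀ (Or.inl rfl) h1 h2 (by omega) le_rfl)
            (hK A₀ (2 * B) mm m' hA₀ (Or.inr rfl) h1 h2 (by omega) (by omega))
        _ = 2 * Z₀ := by ring
  rcases le_or_gt m (2 * A) with hle | hgt
  · calc _ ≤ 2 * Z₀ := hq A m (Or.inl rfl) hm.1 hle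
      _ ≤ 4 * Z₀ := by linarith
  · have hsplit : ∑ n ∈ Ioc A m, ∑ q ∈ Ioc B m', f n q =
        ∑ n ∈ Ioc A (2 * A), ∑ q ∈ Ioc B m', f n q + ∑ n ∈ Ioc (2 * A) m, ∑ q ∈ Ioc B m', f n q :=
      (Finset.sum_Ioc_consecutive _ (by omega) (by omega)).symm
    rw [hsplit]
    calc _ ≤ ‖∑ n ∈ Ioc A (2 * A), ∑ q ∈ Ioc B m', f n q‖ +
          ‖∑ n ∈ Ioc (2 * A) m, ∑ q ∈ Ioc B m', f n q‖ := norm_add_le _ _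
      _ ≤ 2 * Z₀ + 2 * Z₀ := add_le_add (hq A (2 * A) (Or.inl rfl) (by omega) le_rfl)
          (hq (2 * A) m (Or.inr rfl) (by omega) (by omega))
      _ = 4 * Z₀ := by ring

/-- Telescoping of `log`: `Σ_{A ≤ m < A'} (log(m+1) − log m) = log A' − log A`. [folklore] -/
theorem sum_Ico_log_succ_sub_log {A A' : ℕ} (h : A ≤ A') :
    ∑ m ∈ Ico A A', (Real.log ((m + 1 : ℕ) : ℝ) - Real.log (m : ℝ)) =
      Real.log (A' : ℝ) - Real.log (A : ℝ) := by
  induction A', h using Nat.le_induction with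
  | base => simp
  | succ n hn ih =>
    rw [Finset.sum_Ico_succ_top hn, ih]
    push_cast
    ring

/-- **Variation of the Type I weight** `u(n) = a₁ log n + a₀` with `|a₁| ≤ 1` on `[A, A']`, `A ≥ 1`:
`Σ ‖u(m+1) − u(m)‖ ≤ log A' − log A`. [folklore] -/
theorem log_weight_variation (a₁ a₀ : ℝ) (ha₁ : |a₁| ≤ 1) {A A' : ℕ} (hA : 1 ≤ A) (h : A ≤ A') :
    ∑ m ∈ Ico A A', ‖(((a₁ * Real.log ((m + 1 : ℕ) : ℝ) + a₀ : ℝ)) : ℂ) -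
        (((a₁ * Real.log (m : ℝ) + a₀ : ℝ)) : ℂ)‖ ≤ Real.log (A' : ℝ) - Real.log (A : ℝ) := by
  rw [← sum_Ico_log_succ_sub_log h]
  refine Finset.sum_le_sum fun m hm => ?_
  have hm1 : (1 : ℝ) ≤ m := by exact_mod_cast hA.trans (Finset.mem_Ico.mp hm).1
  have hlog : Real.log (m : ℝ) ≤ Real.log ((m + 1 : ℕ) : ℝ) :=
    Real.log_le_log (by linarith) (by push_cast; linarith)
  rw [← Complex.ofReal_sub, Complex.norm_real, Real.norm_eq_abs,
    show a₁ * Real.log ((m + 1 : ℕ) : ℝ) + a₀ - (a₁ * Real.log (m : ℝ) + a₀) =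
      a₁ * (Real.log ((m + 1 : ℕ) : ℝ) - Real.log (m : ℝ)) by ring, abs_mul,
    abs_of_nonneg (by linarith : (0 : ℝ) ≤ Real.log ((m + 1 : ℕ) : ℝ) - Real.log (m : ℝ))]
  calc _ ≤ 1 * (Real.log ((m + 1 : ℕ) : ℝ) - Real.log (m : ℝ)) :=
        mul_le_mul_of_nonneg_right ha₁ (by linarith)
    _ = _ := one_mul _

/-- The Type I weight at the endpoint: `‖a₁ log A' + a₀‖ ≤ log A' + |a₀|` (`A' ≥ 1`, `|a₁| ≤ 1`).
[folklore] -/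
theorem norm_log_weight_le (a₁ a₀ : ℝ) (ha₁ : |a₁| ≤ 1) {A' : ℕ} (hA' : 1 ≤ A') :
    ‖(((a₁ * Real.log (A' : ℝ) + a₀ : ℝ)) : ℂ)‖ ≤ Real.log (A' : ℝ) + |a₀| := by
  rw [Complex.norm_real, Real.norm_eq_abs]
  have hlog : 0 ≤ Real.log (A' : ℝ) := Real.log_nonneg (by exact_mod_cast hA')
  calc |a₁ * Real.log (A' : ℝ) + a₀| ≤ |a₁ * Real.log (A' : ℝ)| + |a₀| := abs_add_le _ _
    _ = |a₁| * Real.log (A' : ℝ) + |a₀| := by rw [abs_mul, abs_of_nonneg hlog]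
    _ ≤ 1 * Real.log (A' : ℝ) + |a₀| := by gcongr
    _ = _ := by rw [one_mul]

/-- **Variation of a non-increasing non-negative weight**: `‖w(a')‖ + Σ_{a ≤ m < a'} ‖w(m+1) − w(m)‖
= w(a)` (real weights cast to `ℂ`). [folklore] -/
theorem antitone_weight_variation (w : ℕ → ℝ) {a a' : ℕ} (h : a ≤ a')
    (hmono : ∀ m, a ≤ m → m < a' → w (m + 1) ≤ w m) (hpos : 0 ≤ w a') :
    ‖((w a' : ℝ) : ℂ)‖ + ∑ m ∈ Ico a a', ‖((w (m + 1) : ℝ) : ℂ) - ((w m : ℝ) : ℂ)‖ = w a := by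
  have htel : ∀ a'' : ℕ, a ≤ a'' → a'' ≤ a' →
      ∑ m ∈ Ico a a'', ‖((w (m + 1) : ℝ) : ℂ) - ((w m : ℝ) : ℂ)‖ = w a - w a'' := by
    intro a'' h1 h2
    induction a'', h1 using Nat.le_induction with
    | base => simp
    | succ n hn ih =>
      rw [Finset.sum_Ico_succ_top hn, ih (by omega)]
      rw [← Complex.ofReal_sub, Complex.norm_real, Real.norm_eq_abs,
        abs_of_nonpos (by linarith [hmono n hn (by omega)])]
      ring
  rw [htel a' h le_rfl, Complex.norm_real, Real.norm_eq_abs, abs_of_nonneg hpos]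
  ring

end Summit.Parity.BatemanHorn.Cruxes.SplitBlockJacobiCorner.Sketch.MbbOfBoxInputs

namespace Summit.Parity.BatemanHorn.Cruxes.SplitBlockJacobiCorner.Sketch

/-- **Registered stub form** (telescoping of `log`, the variation of the Type I weight): restated in
`∀`-form in the crux-line namespace under the name registered on stmt-Parity-15002. [folklore] -/
theorem mbbPieceI_log_telescope :
    ∀ A A' : ℕ, A ≤ A' → ∑ m ∈ Finset.Ico A A', (Real.log ((m + 1 : ℕ) : ℝ) - Real.log (m : ℝ)) = Real.log (A' : ℝ) - Real.log (A : ℝ) :=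
  fun _ _ h => MbbOfBoxInputs.sum_Ico_log_succ_sub_log h

end Summit.Parity.BatemanHorn.Cruxes.SplitBlockJacobiCorner.Sketch

end
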